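import Summits.BirchSwinnertonDyer.Rank1Residual.X12.CMTamagawaThree
import Summits.BirchSwinnertonDyer.Rank1Residual.X12.InertBadOddPrime
import Summits.BirchSwinnertonDyer.Rank1Residual.X12.InertCoreInstancesA
import Literature.NumberTheory.EllipticCurves.OggFormulaJ1728TwoProofs
import HarnessLib

/-!
# `y² = x³ + Ax` (`j = 1728`): `3` never divides the Tamagawa product — the place `3` included;
# hence the inert-BAD-at-`3` sub-family of X12 with `K = ℚ(i)` loses its Tamagawa datum

HONEST FRAMING (cell `b2b-bsdres`, run/shared/lean/b2b/bsd-rank1-residual/, verbatim in every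
file): the goal of the cell is to DELETE the COMBINATION-SHAPED residual classes of the
Birch–Swinnerton-Dyer formula for ALL analytic-rank `≤ 1` elliptic curves over `ℚ` — "full BSD
formula for every rank `≤ 1` curve in class `C`" assembled STRICTLY from published theorems — so
that the rank-`≤ 1` remainder becomes exactly the CONSTRUCTION-SHAPED classes, which are TYPED
(missing-input `Prop`s), NOT attempted. This is not "finishing BSD". Unit `b2b-bsdres-x1b` (X12
prover owner), generation 22; research route, no claim beyond the stated class; X12 REMAINS
CONSTRUCTION-SHAPED; nothing is booked here — booking is the lane's and the referee's.

Theorems only; no definition, no new named fact.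

`CMTamagawaThree.lean` (same gen) shows `3 ∤ c_v` at every place `v ∤ 3` of a CM curve whose CM
field is not `ℚ(√−3)`, and at `v ∣ 3` when the reduction is GOOD; at an ADDITIVE `v ∣ 3` the types
`IV`/`IV*` are not excluded by `ord₃ Δ_min` alone. This file settles the place `3` for **`j = 1728`**
(`K = ℚ(i)`; every such curve is `y² = x³ + Ax`, `exists_variableChange_eq_of_j_eq_1728`) by TATE'S
ALGORITHM run in the kernel: §1 engine `kodairaSymbolAt_of_quartic_model` — at a place `v ∤ 2` a
model `y² = x³ + ax` with `ord_v a = s ∈ {1, 2, 3}` has type `III`, `I₀*`, `III*` (Silverman *ATAEC*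
IV.9.4 Step 4: `π³ ∤ b₈ = −a²`; Step 6: `T³ + (a/π²)T` has three distinct roots in `k̄` as `2 ≠ 0`;
Step 9: `π⁴ ∤ a₄`; tree `kodairaSymbolOfMinimal_eq_III_of_step2 / _Istar_zero_of_step6 /
_IIIstar_of_step9`; the equation is minimal, `ord_v Δ = 3s < 12`); §2 at the place over `3`, after
rescaling `A ↦ A/3^{4k}` to `ord₃ = s ∈ {0,1,2,3}`: `s = 0` is good reduction, `s ≥ 1` a type of
component-group order `2, 4, 2`, so `c_3 ∣ #Φ(𝔽̄₃)` is never divisible by `3`; §3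
**`not_three_dvd_tamagawaProduct_of_j_eq_1728`: for EVERY elliptic curve over `ℚ` with `j = 1728`,
`3 ∤ ∏_ℓ c_ℓ`** (places `v ∤ 3` from `CMTamagawaThree.lean`: `1728 = 12³`, no multiplicative
place); §4 consumers: gen 12's `p = 3` inert-bad theorems of `InertBadOddPrime.lean` WITHOUT the
Tamagawa datum for `j = 1728` (`3 ∣ N`: `y² = x³ + Ax` with `3 ∣ A`, the bulk of the 154
inert-bad-at-`3` classes `N < 5·10⁵`): the upper half of `BSD(E,3)` modulo the Manin datum only.

Not claimed: the place `3` for the other CM `j`-invariants with `d_K ≠ −3` (quadratic twists of a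
curve good at `3` by a parameter divisible by `3`: type `I₀*`, whose Step-6 cubic needs a
residue-field computation not carried out here); anything at `p = 2`; the lower half.

References: [SilvermanATAEC1994] IV.9.4, Table 4.1, Cor. IV.9.2; [SilvermanAEC2009] VII.1 Rem. 1.1,
X.5.4 (iii); [MatarNekovar2019] Thm. 0.3; [Miller2011LMS] Def. 1.1; HOME `b2b-bsdres-x1b/X12-ROUTE.md` §26.
-/

noncomputable section

open scoped Classical NumberField

open WeierstrassCurve NumberField IsDedekindDomain IsDedekindDomain.HeightOneSpectrum Field
  Rat.HeightOneSpectrum Literature.NumberTheory.EllipticCurves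
  Literature.NumberTheory.GaloisRepresentations
  Literature.NumberTheory.EllipticCurves.ModularForms
  Literature.NumberTheory.EllipticCurves.Rank1Residual
  Literature.NumberTheory.EllipticCurves.Rank1Residual.Typed
  Literature.NumberTheory.Automorphic
  Literature.NumberTheory.DiophantineGeometry
  Literature.NumberTheory.DiophantineGeometry.TateAlgorithm

namespace Summit.BirchSwinnertonDyer.Rank1Residual.X12

/-- An element of `O_v` of valuation exactly `exp(-n)` is not divisible by `ϖⁿ⁺¹`. [folklore] -/
private theorem not_pow_succ_dvd_of_valued_eq' (v : HeightOneSpectrum (𝓞 ℚ))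
    {x : v.adicCompletionIntegers ℚ} {n : ℕ}
    (h : Valued.v (x : v.adicCompletion ℚ) = WithZero.exp (-(n : ℤ))) :
    ¬ uniformizer (v.adicCompletionIntegers ℚ) ^ (n + 1) ∣ x := by
  have hϖ : Irreducible (uniformizer (v.adicCompletionIntegers ℚ)) := irreducible_uniformizer
  obtain ⟨u, hu, hx⟩ := exists_isUnit_eq_uniformizer_pow_mul_of_valued_eq v h
  rintro ⟨c, hc⟩
  rw [hx, pow_succ, mul_assoc] at hc
  have hc' : u = uniformizer (v.adicCompletionIntegers ℚ) * c :=
    mul_left_cancel₀ (pow_ne_zero n hϖ.ne_zero) hc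
  exact hϖ.not_isUnit (isUnit_of_mul_isUnit_left (hc' ▸ hu))

/-- Scaling `(u; 0, 0, 0)` of `y² = x³ + ax`: `y² = x³ + (a/u⁴)x`. [folklore] -/
theorem smul_quartic_scale (u : ℚˣ) (a : ℚ) :
    (⟨u, 0, 0, 0⟩ : VariableChange ℚ) • (⟨0, 0, 0, a, 0⟩ : WeierstrassCurve ℚ) =
      ⟨0, 0, 0, (u⁻¹ : ℚˣ) ^ 4 * a, 0⟩ := by
  ext <;> simp [variableChange_a₁, variableChange_a₂, variableChange_a₃, variableChange_a₄,
    variableChange_a₆]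

/-! ### §1 Engine: Tate's algorithm on `y² = x³ + ax` at a place `v ∤ 2` with `ord_v a ∈ {1, 2, 3}` -/

/-- **Tate's algorithm on `y² = x³ + ax` at a finite place `v ∤ 2`: `ord_v a = 1, 2, 3` give
Kodaira types `III`, `I₀*`, `III*`** (for a `ℚ`-model `M = D • W = (y² = x³ + ax)`, `v(a) = exp(-s)`;
minimal at `v` since `ord_v Δ = 3s < 12`, *AEC* VII.1 Rem. 1.1; Steps 4 / 6 / 9 of *ATAEC* IV.9.4 via
`kodairaSymbolOfMinimal_eq_III_of_step2 / _Istar_zero_of_step6 / _IIIstar_of_step9`).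
[cite: SilvermanATAEC1994, IV.9.4 Steps 1–9 (PDF pp. 344–346) and Table 4.1]
[cite: SilvermanAEC2009, VII.1 Remark 1.1] -/
theorem kodairaSymbolAt_of_quartic_model (W : WeierstrassCurve ℚ) [W.IsElliptic]
    (v : HeightOneSpectrum (𝓞 ℚ)) (hv2 : natGenerator v ≠ 2)
    (M : WeierstrassCurve ℚ) (D : VariableChange ℚ) (hM : M = D • W) {a : ℚ}
    (hMa : M = ⟨0, 0, 0, a, 0⟩) {s : ℕ} (hs1 : 1 ≤ s) (hs3 : s ≤ 3)
    (ha : v.valuation ℚ a = WithZero.exp (-(s : ℤ))) :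
    W.kodairaSymbolAt v = .III ∨ W.kodairaSymbolAt v = .Istar 0 ∨ W.kodairaSymbolAt v = .IIIstar := by
  haveI := perfectField_residueField_adicCompletionIntegers (K := ℚ) v
  haveI hMell : M.IsElliptic := by rw [hM]; infer_instance
  have hp2 : ¬ (natGenerator v : ℤ) ∣ 2 := fun h ↦ hv2 <| by
    have h' : natGenerator v ∣ 2 := by exact_mod_cast h
    exact (Nat.prime_dvd_prime_iff_eq (prime_natGenerator v) Nat.prime_two).mp h'
  have h2 : v.valuation ℚ (2 : ℚ) = 1 := by
    have := Rat.valuation_intCast_eq_one v hp2; exact_mod_cast this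
  have hc2 : ringChar (𝓞 ℚ ⧸ v.asIdeal) ≠ 2 := by
    rw [X2.ringChar_quot_asIdeal_eq_primesEquiv]; exact hv2
  -- the coefficients of `M`
  have e₁ : M.a₁ = 0 := by rw [hMa]
  have e₂ : M.a₂ = 0 := by rw [hMa]
  have e₃ : M.a₃ = 0 := by rw [hMa]
  have e₄ : M.a₄ = a := by rw [hMa]
  have e₆ : M.a₆ = 0 := by rw [hMa]
  have eb₂ : M.b₂ = 0 := by rw [hMa]; simp [WeierstrassCurve.b₂]
  have eb₈ : M.b₈ = -a ^ 2 := by rw [hMa]; simp [WeierstrassCurve.b₈]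
  have eΔ : M.Δ = -(2 : ℚ) ^ 6 * a ^ 3 := by
    rw [hMa]; simp only [WeierstrassCurve.Δ, WeierstrassCurve.b₂, WeierstrassCurve.b₄,
      WeierstrassCurve.b₆, WeierstrassCurve.b₈]; ring
  have hexp1 : WithZero.exp (-(s : ℤ)) ≤ (1 : WithZero (Multiplicative ℤ)) := by
    rw [← WithZero.exp_zero, WithZero.exp_le_exp]; omega
  -- integrality and minimality of `X = M ⊗ ℚ_v`
  have hint : M.IsIntegralAt v :=
    M.isIntegralAt_of_valuation_le_one v (by rw [e₁, map_zero]; exact zero_le_one)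
      (by rw [e₂, map_zero]; exact zero_le_one) (by rw [e₃, map_zero]; exact zero_le_one)
      (by rw [e₄, ha]; exact hexp1) (by rw [e₆, map_zero]; exact zero_le_one)
  have hΔ : v.valuation ℚ M.Δ = WithZero.exp (-((3 * s : ℕ) : ℤ)) := by
    rw [eΔ, map_mul, Valuation.map_neg, map_pow, h2, one_pow, one_mul, map_pow, ha,
      ← WithZero.exp_nsmul]
    congr 1; push_cast; ring
  have hmin : M.IsMinimalAt v :=
    isMinimalAt_of_lt_valuation_Δ_holds hint (by rw [hΔ]; exact WithZero.exp_lt_exp.mpr (by omega))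
  set X := M.baseChange (v.adicCompletion ℚ) with hX
  haveI hXint : X.IsIntegral (v.adicCompletionIntegers ℚ) := hint
  haveI hXmin : X.IsMinimal (v.adicCompletionIntegers ℚ) := hmin
  haveI hXell : X.IsElliptic := by rw [hX, WeierstrassCurve.baseChange]; infer_instance
  set I := X.integralModel (v.adicCompletionIntegers ℚ) with hI
  -- valuations of the coefficients of the `O_v`-model
  have hva : ∀ (x : v.adicCompletionIntegers ℚ) (q : ℚ),
      algebraMap (v.adicCompletionIntegers ℚ) (v.adicCompletion ℚ) x =
        algebraMap ℚ (v.adicCompletion ℚ) q →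
      Valued.v (x : v.adicCompletion ℚ) = v.valuation ℚ q := by
    intro x q h
    rw [show (x : v.adicCompletion ℚ) = algebraMap _ (v.adicCompletion ℚ) x from rfl, h,
      WeierstrassCurve.valued_algebraMap_adicCompletion]
  have hIa₁ : Valued.v ((I.a₁ : v.adicCompletionIntegers ℚ) : v.adicCompletion ℚ) = 0 := by
    rw [hva _ _ (by rw [hI, integralModel_a₁_eq, hX, WeierstrassCurve.baseChange, map_a₁]), e₁,
      map_zero]
  have hIa₂ : Valued.v ((I.a₂ : v.adicCompletionIntegers ℚ) : v.adicCompletion ℚ) = 0 := by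
    rw [hva _ _ (by rw [hI, integralModel_a₂_eq, hX, WeierstrassCurve.baseChange, map_a₂]), e₂,
      map_zero]
  have hIa₃ : Valued.v ((I.a₃ : v.adicCompletionIntegers ℚ) : v.adicCompletion ℚ) = 0 := by
    rw [hva _ _ (by rw [hI, integralModel_a₃_eq, hX, WeierstrassCurve.baseChange, map_a₃]), e₃,
      map_zero]
  have hIa₄ : Valued.v ((I.a₄ : v.adicCompletionIntegers ℚ) : v.adicCompletion ℚ) =
      WithZero.exp (-(s : ℤ)) := by
    rw [hva _ _ (by rw [hI, integralModel_a₄_eq, hX, WeierstrassCurve.baseChange, map_a₄]), e₄, ha]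
  have hIa₆ : Valued.v ((I.a₆ : v.adicCompletionIntegers ℚ) : v.adicCompletion ℚ) = 0 := by
    rw [hva _ _ (by rw [hI, integralModel_a₆_eq, hX, WeierstrassCurve.baseChange, map_a₆]), e₆,
      map_zero]
  have hIb₂ : Valued.v ((I.b₂ : v.adicCompletionIntegers ℚ) : v.adicCompletion ℚ) = 0 := by
    rw [hva _ _ (by rw [hI, integralModel_b₂_eq, hX, WeierstrassCurve.baseChange, map_b₂]), eb₂,
      map_zero]
  have hIb₈ : Valued.v ((I.b₈ : v.adicCompletionIntegers ℚ) : v.adicCompletion ℚ) =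
      WithZero.exp (-((2 * s : ℕ) : ℤ)) := by
    rw [hva _ _ (by rw [hI, integralModel_b₈_eq, hX, WeierstrassCurve.baseChange, map_b₈]), eb₈,
      Valuation.map_neg, map_pow, ha, ← WithZero.exp_nsmul]
    congr 1; push_cast; ring
  have hIΔ : Valued.v ((I.Δ : v.adicCompletionIntegers ℚ) : v.adicCompletion ℚ) =
      WithZero.exp (-((3 * s : ℕ) : ℤ)) := by
    rw [← hΔ]
    exact hva _ _ (by rw [hI, integralModel_Δ_eq, hX, WeierstrassCurve.baseChange, map_Δ])
  -- divisibilities on the `O_v`-model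
  set ϖ := uniformizer (v.adicCompletionIntegers ℚ) with hϖ
  have dvdk : ∀ {x : v.adicCompletionIntegers ℚ} (k : ℕ),
      Valued.v (x : v.adicCompletion ℚ) ≤ WithZero.exp (-(k : ℤ)) → ϖ ^ k ∣ x := fun {x} k hx ↦
    uniformizer_pow_dvd_of_valued_le v (x := x) (n := k) hx
  have dvd0 : ∀ {x : v.adicCompletionIntegers ℚ} (k : ℕ),
      Valued.v (x : v.adicCompletion ℚ) = 0 → ϖ ^ k ∣ x := fun {x} k hx ↦
    dvdk k (by rw [hx]; exact zero_le)
  have ha₄k : ∀ k : ℕ, k ≤ s → ϖ ^ k ∣ I.a₄ := fun k hk ↦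
    dvdk k (by rw [hIa₄]; exact WithZero.exp_le_exp.mpr (by omega))
  have ha₄n : ¬ ϖ ^ (s + 1) ∣ I.a₄ := not_pow_succ_dvd_of_valued_eq' v hIa₄
  have dvd0' : ∀ {x : v.adicCompletionIntegers ℚ},
      Valued.v (x : v.adicCompletion ℚ) = 0 → ϖ ∣ x := fun {x} hx ↦ by
    have := dvd0 (x := x) 1 hx; rwa [pow_one] at this
  -- Tate's algorithm
  have hK : I.kodairaSymbolOfMinimal = .III ∨ I.kodairaSymbolOfMinimal = .Istar 0 ∨
      I.kodairaSymbolOfMinimal = .IIIstar := by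
    have nΔ : ϖ ∣ I.Δ := by
      have := dvdk (x := I.Δ) 1 (by rw [hIΔ]; exact WithZero.exp_le_exp.mpr (by omega))
      rwa [pow_one] at this
    have n3 : ϖ ∣ I.a₃ := by have := dvd0 (x := I.a₃) 1 hIa₃; rwa [pow_one] at this
    have n4 : ϖ ∣ I.a₄ := by have := ha₄k 1 hs1; rwa [pow_one] at this
    have n6 : ϖ ∣ I.a₆ := by have := dvd0 (x := I.a₆) 1 hIa₆; rwa [pow_one] at this
    have nb₂ : ϖ ∣ I.b₂ := by have := dvd0 (x := I.b₂) 1 hIb₂; rwa [pow_one] at this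
    rcases (show s = 1 ∨ s = 2 ∨ s = 3 by omega) with rfl | rfl | rfl
    · -- `s = 1`: type `III`
      refine Or.inl (kodairaSymbolOfMinimal_eq_III_of_step2 nΔ n3 n4 n6 nb₂ (dvd0 2 hIa₆) ?_)
      intro h3
      exact not_pow_succ_dvd_of_valued_eq' v (n := 2) hIb₈ h3
    · -- `s = 2`: type `I₀*`
      refine Or.inr (Or.inl (kodairaSymbolOfMinimal_eq_Istar_zero_of_step6 (dvd0' hIa₁)
        (dvd0' hIa₂) (dvd0 2 hIa₃) (ha₄k 2 le_rfl) (dvd0 3 hIa₆) ?_))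
      have hu2 : IsUnit (2 : v.adicCompletionIntegers ℚ) :=
        HeightOneSpectrum.isUnit_two_adicCompletionIntegers ℚ v hc2
      have hq : redCoeff I.a₄ 2 ≠ 0 := fun h0 ↦ ha₄n ((redCoeff_eq_zero_iff (ha₄k 2 le_rfl)).mp h0)
      rw [cubicStep6, redCoeff_eq_zero_of_dvd (j := 1) (dvd0 2 hIa₂),
        redCoeff_eq_zero_of_dvd (j := 3) (dvd0 4 hIa₆), distinctRootCount_cubic_eq_three_iff]
      have h2k := residue_two_ne_zero hu2
      intro hdisc
      apply hq
      have h4 : (4 : IsLocalRing.ResidueField (v.adicCompletionIntegers ℚ)) ≠ 0 := by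
        rw [show (4 : IsLocalRing.ResidueField (v.adicCompletionIntegers ℚ)) = 2 * 2 by norm_num]
        exact mul_ne_zero h2k h2k
      have : (4 : IsLocalRing.ResidueField (v.adicCompletionIntegers ℚ)) * redCoeff I.a₄ 2 ^ 3 = 0 := by
        linear_combination -hdisc
      rcases mul_eq_zero.mp this with h | h
      · exact absurd h h4
      · exact pow_eq_zero_iff (n := 3) (by norm_num) |>.mp h
    · -- `s = 3`: type `III*`
      exact Or.inr (Or.inr (kodairaSymbolOfMinimal_eq_IIIstar_of_step9 (dvd0' hIa₁) (dvd0 2 hIa₂)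
        (dvd0 3 hIa₃) (ha₄k 3 le_rfl) (dvd0 5 hIa₆) ha₄n))
  -- read `kodairaSymbolAt` of `W` on the minimal model `X`
  have hrel : X = (D.map (algebraMap ℚ (v.adicCompletion ℚ))) • W.baseChange (v.adicCompletion ℚ) := by
    rw [hX, hM, WeierstrassCurve.baseChange, WeierstrassCurve.baseChange, map_variableChange]
  rw [W.kodairaSymbolAt_eq_kodairaSymbolOfMinimal_of_isMinimal v X _ hrel X.isUnit_Δ.ne_zero, ← hI]
  exact hK

/-! ### §2 The place `3` of `y² = x³ + Ax` -/

/-- **`3 ∤ c_3(y² = x³ + Ax)`.** At the place `v` over `3`, rescale `A = 2^r A₀` (`A₀` odd) by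
`u = 3^k`, `4k ≤ ord₃ A₀ < 4k + 4`, to `ord₃ a = s ∈ {0, 1, 2, 3}`: `s = 0` is good reduction (type
neither `Iₙ`, `n ≥ 1`, nor `IV`, `IV*`), `s ≥ 1` is `III`, `I₀*`, `III*` (`kodairaSymbolAt_of_quartic_model`),
of component-group order `2, 4, 2`; and `c_v ∣ #Φ(k̄)` (`localTamagawaNumber_dvd_componentGroupOrder`).
[cite: SilvermanATAEC1994, IV.9.4, Table 4.1 and Cor. IV.9.2 (c),(d)] -/
theorem not_three_dvd_localTamagawaNumber_three_of_j_eq_1728 (W : WeierstrassCurve ℚ)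
    [W.IsElliptic] (hj : W.j = 1728) (v : HeightOneSpectrum (𝓞 ℚ)) (hv : natGenerator v = 3) :
    ¬ 3 ∣ (W.baseChange (v.adicCompletion ℚ)).localTamagawaNumber (v.adicCompletionIntegers ℚ) := by
  haveI : Finite (IsLocalRing.ResidueField (v.adicCompletionIntegers ℚ)) :=
    HeightOneSpectrum.finite_residueField_adicCompletionIntegers ℚ v
  haveI : PerfectField (IsLocalRing.ResidueField (v.adicCompletionIntegers ℚ)) :=
    PerfectField.ofFinite
  -- valuations at `v` of `2` and `3`
  have h3 : v.valuation ℚ (3 : ℚ) = WithZero.exp (-1 : ℤ) := by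
    have := Rat.valuation_natGenerator v; rwa [hv, Nat.cast_ofNat] at this
  have h2 : v.valuation ℚ (2 : ℚ) = 1 := by
    have := Rat.valuation_intCast_eq_one v (n := 2) (by rw [hv]; decide)
    exact_mod_cast this
  -- the quartic model and its `3`-adic normalisation
  obtain ⟨r, A₀, C, -, hA₀, hC⟩ := exists_variableChange_eq_of_j_eq_1728 W hj
  have hA₀0 : A₀ ≠ 0 := fun h ↦ by simp [h] at hA₀
  obtain ⟨A₁, hA₁, h3A₁⟩ := (Int.finiteMultiplicity_iff.mpr ⟨by norm_num, hA₀0⟩ :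
    FiniteMultiplicity (3 : ℤ) A₀).exists_eq_pow_mul_and_not_dvd
  set n := multiplicity (3 : ℤ) A₀ with hn
  obtain ⟨k, s, hs4, hns⟩ : ∃ k s : ℕ, s < 4 ∧ n = 4 * k + s := ⟨n / 4, n % 4, Nat.mod_lt _ (by norm_num),
    (Nat.div_add_mod n 4).symm⟩
  -- `a = 2^r · 3^s · A₁`, the coefficient of the rescaled model
  set u : ℚˣ := Units.mk0 ((3 : ℚ) ^ k) (by positivity) with hu
  set a : ℚ := (2 : ℚ) ^ r * ((3 : ℚ) ^ s * A₁) with ha_def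
  have hscale : (⟨u, 0, 0, 0⟩ : VariableChange ℚ) • (C • W) = ⟨0, 0, 0, a, 0⟩ := by
    rw [hC, smul_quartic_scale]
    congr 1
    have hu4 : ((u⁻¹ : ℚˣ) : ℚ) ^ 4 = ((3 : ℚ) ^ (4 * k))⁻¹ := by
      rw [Units.val_inv_eq_inv_val, hu, Units.val_mk0, inv_pow, ← pow_mul, mul_comm]
    rw [hu4, hA₁, hns, ha_def]; push_cast
    have h3k : ((3 : ℚ) ^ (4 * k)) ≠ 0 := by positivity
    field_simp; ring
  have hva : v.valuation ℚ a = WithZero.exp (-(s : ℤ)) := by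
    have hA₁v : v.valuation ℚ (A₁ : ℚ) = 1 := Rat.valuation_intCast_eq_one v (by rw [hv]; exact_mod_cast h3A₁)
    rw [ha_def, map_mul, map_pow, h2, one_pow, one_mul, map_mul, map_pow, h3, hA₁v, mul_one,
      ← WithZero.exp_nsmul]
    simp
  -- `c_v ∣ #Φ(k̄)`
  intro hdvd
  have hcgo : 3 ∣ (W.kodairaSymbolAt v).componentGroupOrder :=
    hdvd.trans (localTamagawaNumber_dvd_componentGroupOrder v W (nonempty_neronComponentData_holds W v))
  rcases Nat.eq_zero_or_pos s with hs0 | hs1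
  · -- `s = 0`: good reduction at `v`
    subst hs0
    set M : WeierstrassCurve ℚ := ⟨0, 0, 0, a, 0⟩ with hMdef
    have hM : M = ((⟨u, 0, 0, 0⟩ : VariableChange ℚ) * C) • W := by rw [mul_smul, hscale]
    haveI : M.IsElliptic := by rw [hM]; infer_instance
    have hva1 : v.valuation ℚ a = 1 := by rw [hva]; simp
    have hint : M.IsIntegralAt v :=
      M.isIntegralAt_of_valuation_le_one v (by simp [hMdef]) (by simp [hMdef]) (by simp [hMdef])
        (by rw [show M.a₄ = a from rfl, hva1]) (by simp [hMdef])
    have hΔ1 : v.valuation ℚ M.Δ = 1 := by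
      rw [show M.Δ = -(2 : ℚ) ^ 6 * a ^ 3 by
        simp only [hMdef, WeierstrassCurve.Δ, WeierstrassCurve.b₂, WeierstrassCurve.b₄,
          WeierstrassCurve.b₆, WeierstrassCurve.b₈]; ring,
        map_mul, Valuation.map_neg, map_pow, h2, one_pow, one_mul, map_pow, hva1, one_pow]
    have hmin : M.IsMinimalAt v :=
      isMinimalAt_of_lt_valuation_Δ_holds hint (by rw [hΔ1, ← WithZero.exp_zero]; exact WithZero.exp_lt_exp.mpr (by norm_num))
    have hgoodM : M.HasGoodReductionAt v := (hasGoodReductionAt_iff_of_isMinimalAt (v := v) (W := M) hmin).mpr hΔ1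
    have hgood : W.HasGoodReductionAt v := by
      rw [hM] at hgoodM
      exact (hasGoodReductionAt_smul_iff_holds v W _).mp hgoodM
    rcases kodairaSymbol_of_three_dvd_componentGroupOrder hcgo with ⟨m, hm, hk⟩ | hk | hk
    · exact hgood.not_hasMultiplicativeReductionAt ((kodairaSymbolAt_eq_I_iff_holds v W hm).mp hk).1
    · exact hgood.not_hasAdditiveReductionAt
        ((isAdditive_kodairaSymbolAt_iff_holds v W).mp (hk ▸ by decide))
    · exact hgood.not_hasAdditiveReductionAt
        ((isAdditive_kodairaSymbolAt_iff_holds v W).mp (hk ▸ by decide))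
  · -- `s ∈ {1, 2, 3}`: types `III`, `I₀*`, `III*`
    have hT := kodairaSymbolAt_of_quartic_model W v (by rw [hv]; decide) _
      ((⟨u, 0, 0, 0⟩ : VariableChange ℚ) * C) (by rw [mul_smul, hscale]) rfl hs1 (by omega) hva
    rcases hT with hT | hT | hT <;> rw [hT] at hcgo <;>
      simp [KodairaSymbol.componentGroupOrder] at hcgo

/-! ### §3 `3 ∤ ∏_ℓ c_ℓ` for every `y² = x³ + Ax` -/

/-- **For every elliptic curve over `ℚ` with `j = 1728` (`y² = x³ + Ax`, CM by `ℤ[i]`), `3 ∤ ∏_ℓ c_ℓ`**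
(globally minimal equation): the place over `3` by `not_three_dvd_localTamagawaNumber_three_of_j_eq_1728`,
every other place by the cube-discriminant argument of `CMTamagawaThree.lean` (`1728 = 12³`; no
multiplicative place). [cite: SilvermanATAEC1994, IV.9.4, Table 4.1, Cor. IV.9.2 and IV.11.1] -/
theorem not_three_dvd_tamagawaProduct_of_j_eq_1728 (W : WeierstrassCurve ℚ) [W.IsElliptic]
    [W.IsGloballyMinimal] (hj : W.j = 1728) : ¬ 3 ∣ W.tamagawaProduct := by
  have hCM : W.HasCM := hasCM_of_j_eq_1728 W hj
  obtain ⟨s, hs⟩ := exists_Δ_eq_cube_of_j_eq_cube W (t := 12) (by norm_num) (by rw [hj]; norm_num)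
  intro hdvd
  unfold WeierstrassCurve.tamagawaProduct at hdvd
  -- a prime dividing a `finprod` divides a factor
  have hex : ∃ v : HeightOneSpectrum (𝓞 ℚ),
      3 ∣ (W.baseChange (v.adicCompletion ℚ)).localTamagawaNumber (v.adicCompletionIntegers ℚ) := by
    by_cases hfin : (Function.mulSupport fun v : HeightOneSpectrum (𝓞 ℚ) ↦
        (W.baseChange (v.adicCompletion ℚ)).localTamagawaNumber (v.adicCompletionIntegers ℚ)).Finite
    · rw [finprod_eq_prod _ hfin] at hdvd
      obtain ⟨v, -, hv⟩ := (Nat.Prime.prime Nat.prime_three).exists_mem_finset_dvd hdvd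
      exact ⟨v, hv⟩
    · rw [finprod_of_infinite_mulSupport hfin] at hdvd
      exact absurd (Nat.le_of_dvd one_pos hdvd) (by norm_num)
  obtain ⟨v, hv⟩ := hex
  by_cases h3 : natGenerator v = 3
  · exact not_three_dvd_localTamagawaNumber_three_of_j_eq_1728 W hj v h3 hv
  · refine not_three_dvd_localTamagawaNumber_of_Δ_eq_cube W hs v ?_ (fun h ↦ absurd h h3) hv
    intro hm
    haveI := Fact.mk (primesEquiv v).2
    exact W.not_hasMultiplicativeReductionAtPrime_of_hasCM hCM (primesEquiv v : ℕ)
      ((W.hasMultiplicativeReductionAtPrime_iff_hasMultiplicativeReductionAt_ringOfIntegers v).mpr hm)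

/-! ### §4 Consumers: the inert-BAD-at-`3` sub-family of X12 with `K = ℚ(i)` loses its Tamagawa datum -/

section Consumers

variable
  (hGZ : ∀ (N : ℕ) [NeZero N] (W : WeierstrassCurve ℚ) (K : Type) [Field K] [NumberField K],
    gross_zagier N W K)
  (hKo : ∀ (N : ℕ) [NeZero N] (W : WeierstrassCurve ℚ) (K : Type) [Field K] [NumberField K],
    kolyvagin N W K)
  (hMN : ∀ (N : ℕ) [NeZero N] (W : WeierstrassCurve ℚ) (K : Type) [Field K] [NumberField K],
    MatarNekovar2019.thm03_padicValNat_card_sha_le_of_irreducible N W K)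
  (hGZK : rank_eq_analyticRank_of_analyticRank_le_one) (hmod : hasEntireLFunction_rat)
  (hnf : exists_isNewformOf) (hFH : friedbergHoffstein_exists_heegnerField_split_twist_ne_zero)
  (hCM8 : bsdTriple_of_hasCM_of_L_one_ne_zero)

include hGZ hKo hMN hGZK hmod hnf hFH hCM8

/-- **`y² = x³ + Ax` with `3 ∣ N`, analytic rank one: the UPPER half of `BSD(E,3)` from published
facts modulo ONLY the Manin datum `3 ∤ c(D)`** (gen 12's `missingUpperBoundAt_three_of_classX12_of_bad`,
`3 ∤ ∏c_ℓ` now a theorem, `3 ∤ d_K = −4`). [cite: MatarNekovar2019, Thm. 0.3 and §0.11]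
[cite: SilvermanATAEC1994, IV.9.4 and Table 4.1] [cite: Miller2011LMS, Def. 1.1] -/
theorem missingUpperBoundAt_three_of_j_eq_1728_of_bad
    (W : WeierstrassCurve ℚ) [W.IsElliptic] [W.IsGloballyMinimal] [NeZero (W.conductorNorm ℤ)]
    (hj : W.j = 1728) (hr : W.analyticRank = 1) (hbad : ¬ Good W 3)
    (D : ModularParametrizationData W (W.conductorNorm ℤ)) (hc : ¬ (3 : ℤ) ∣ D.c) :
    MissingUpperBoundAt W 3 :=
  missingUpperBoundAt_three_of_classX12_of_bad hGZ hKo hMN hGZK hmod hnf hFH hCM8 W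
    (classX12_of_hasCM_of_not_good W 3 (hasCM_of_j_eq_1728 W hj) hr hbad) hbad
    (not_cmRamified_of_j_eq_1728 W hj 3 (by decide)) D hc
    (not_three_dvd_tamagawaProduct_of_j_eq_1728 W hj)

/-- **`y² = x³ + Ax`, `3 ∣ N`, `r_an = 1`: `BSD(E,3) ⟸` the curve's own lower half** (modulo the
Manin datum only). [cite: MatarNekovar2019, Thm. 0.3 and §0.11] [cite: Miller2011LMS, §1 and Def. 1.1] -/
theorem bsdp_three_of_j_eq_1728_of_bad_of_lower
    (W : WeierstrassCurve ℚ) [W.IsElliptic] [W.IsGloballyMinimal] [NeZero (W.conductorNorm ℤ)]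
    (hj : W.j = 1728) (hr : W.analyticRank = 1) (hbad : ¬ Good W 3)
    (D : ModularParametrizationData W (W.conductorNorm ℤ)) (hc : ¬ (3 : ℤ) ∣ D.c)
    (hlowW : MissingLowerBoundAt W 3) : BSDp W 3 :=
  bsdp_three_of_classX12_of_bad_of_lower hGZ hKo hMN hGZK hmod hnf hFH hCM8 W
    (classX12_of_hasCM_of_not_good W 3 (hasCM_of_j_eq_1728 W hj) hr hbad) hbad
    (not_cmRamified_of_j_eq_1728 W hj 3 (by decide)) D hc
    (not_three_dvd_tamagawaProduct_of_j_eq_1728 W hj) hlowW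

/-- **Route T-KR at `p = 3` on `y² = x³ + Ax`, `3 ∣ N`**: published facts + Manin datum + a
CERTIFIED `ord₃ #Ш(E)_an = 0` ⟹ `BSD(E,3)` — no Tamagawa datum.
[cite: MatarNekovar2019, Thm. 0.3 and §0.11] [cite: Miller2011LMS, §1 and Def. 1.1] -/
theorem bsdp_three_of_j_eq_1728_of_bad_of_shaAn_unit
    (W : WeierstrassCurve ℚ) [W.IsElliptic] [W.IsGloballyMinimal] [NeZero (W.conductorNorm ℤ)]
    (hj : W.j = 1728) (hr : W.analyticRank = 1) (hbad : ¬ Good W 3)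
    (D : ModularParametrizationData W (W.conductorNorm ℤ)) (hc : ¬ (3 : ℤ) ∣ D.c)
    {q : ℚ} (hq : shaAn W = (q : ℂ)) (hv : padicValRat 3 q = 0) : BSDp W 3 :=
  bsdp_three_of_classX12_of_bad_of_shaAn_unit hGZ hKo hMN hGZK hmod hnf hFH hCM8 W
    (classX12_of_hasCM_of_not_good W 3 (hasCM_of_j_eq_1728 W hj) hr hbad) hbad
    (not_cmRamified_of_j_eq_1728 W hj 3 (by decide)) D hc
    (not_three_dvd_tamagawaProduct_of_j_eq_1728 W hj) hq hv

end Consumers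

end Summit.BirchSwinnertonDyer.Rank1Residual.X12

end
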